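import Literature.NumberTheory.PAdicHodge.AinfWeierstrassEtaPeriodAdd
import HarnessLib

/-!
# The addition cocycle of `η₀` is a 2-cocycle: `C(u ⊕ v, w) + C(u, v) = C(u, v ⊕ w) + C(v, w)`

Topic `Literature/NumberTheory/PAdicHodge`; sequel of `AinfWeierstrassEtaPeriodAdd` (the INTEGRAL addition cocycle
`C = cocycleInt W ∈ ℤ⟦u, v⟧` of the quasi-period function `η₀` of an integral Weierstrass equation, `C ⊗ ℚ = C₀ =
η₀(u ⊕ v) − η₀(u) − η₀(v)`, and its evaluation `cocycleAt` at points of `𝔫 ⊂ 𝔸_inf(F)`). Since `C₀ = ∂η₀` is a coboundary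
of the formal group `Ŵ`, it is a 2-COCYCLE (Katz 1981 §5.1: the quasi-logarithms are exactly the `f` with `∂f` integral;
`∂∂ = 0`):

* §1 over a `ℚ`-algebra: `C₀(F(u,v), w) + C₀(u, v) = C₀(u, F(v, w)) + C₀(v, w)` in `A⟦u, v, w⟧`
  (`formalQuasiPeriodCocycle_two_cocycle`; both sides equal `η₀(F(F(u,v),w)) − η₀ u − η₀ v − η₀ w` by ASSOCIATIVITY of the
  chord–tangent law, tree `formalGroupLaw_assoc'`);
* §2 over `ℤ`: the same for `cocycleInt W` (`cocycleInt_two_cocycle`, by injectivity of `ℤ⟦u,v,w⟧ → ℚ⟦u,v,w⟧`);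
* §3 at points: **`C(a ⊕_W b, c) + C(a, b) = C(a, b ⊕_W c) + C(b, c)` in `𝔸_inf(F)` for `a, b, c ∈ 𝔫`**
  (`cocycleAt_two_cocycle`), and the `Γ_F`-equivariance `σ C(a, b) = C(σa, σb)` (`gal_cocycleAt`).

Use: the η-integrating element of the Kummer cocycle of a rational point of `Ŵ` (`AinfWeierstrassKummerIntegralEta`, brick K1 of
the hT₂ programme of crux K★ `stmt-BirchSwinnertonDyer-22226`), where the rational constant `Q` is split off Fontaine's element
`[ũ] = Q ⊕ z_u` and `C(Q ⊕ z_u, ·)` must be re-expanded. No named facts, no `sorry`, no new definitions. BSD / K★ are not proved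
by any of this.

## References
* N. M. Katz, *Crystalline cohomology, Dieudonné modules, and Jacobi sums* (1981), §5.1. [Katz1981CrystallineDieudonne]
* J. H. Silverman, *The Arithmetic of Elliptic Curves* (2009), IV.2.1–IV.2.2 (associativity of `F_W`). [SilvermanAEC2009]
* J.-M. Fontaine, *Le corps des périodes p-adiques*, Astérisque 223 (1994), Exp. II §1.2. [FontaineAsterisque223III]
-/

noncomputable section

open Ideal Filter Topology Field WittVector MvPowerSeries

/-! ## §1 The 2-cocycle identity over a `ℚ`-algebra -/

namespace WeierstrassCurve

section RatAlgebra

variable {A : Type*} [CommRing A] [Algebra ℚ A] (V : WeierstrassCurve A)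

/-- **`C₀` along a pair**: `C₀(f, g) = η₀(F(f, g)) − η₀(f) − η₀(g)` for constant-term-free `f, g`.
[cite: Katz1981CrystallineDieudonne, §5.1] -/
theorem subst_pair_formalQuasiPeriodCocycle {σ : Type*} {f g : MvPowerSeries σ A}
    (hf : MvPowerSeries.constantCoeff f = 0) (hg : MvPowerSeries.constantCoeff g = 0) :
    MvPowerSeries.subst ![f, g] V.formalQuasiPeriodCocycle =
      V.formalQuasiPeriod.subst (MvPowerSeries.subst ![f, g] V.formalGroupLaw) - V.formalQuasiPeriod.subst f -
        V.formalQuasiPeriod.subst g := by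
  have hs : MvPowerSeries.HasSubst ![f, g] := WeierstrassCurve.hasSubst_pair hf hg
  rw [formalQuasiPeriodCocycle_def, MvPowerSeries.subst_sub hs, MvPowerSeries.subst_sub hs,
    Literature.NumberTheory.EllipticCurves.mvSubst_powerSeries_subst V.hasSubst_formalGroupLaw hs,
    Literature.NumberTheory.EllipticCurves.mvSubst_powerSeries_subst (PowerSeries.HasSubst.X 0) hs,
    Literature.NumberTheory.EllipticCurves.mvSubst_powerSeries_subst (PowerSeries.HasSubst.X 1) hs,
    MvPowerSeries.subst_X hs, MvPowerSeries.subst_X hs]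
  rfl

/-- **The addition cocycle of `η₀` is a 2-cocycle**: `C₀(F(u,v), w) + C₀(u, v) = C₀(u, F(v,w)) + C₀(v, w)` in `A⟦u, v, w⟧`
(both sides are `η₀(F(F(u,v),w)) − η₀(u) − η₀(v) − η₀(w)`, by associativity of `F`). [cite: Katz1981CrystallineDieudonne, §5.1]
[cite: SilvermanAEC2009, IV.2.1] -/
theorem formalQuasiPeriodCocycle_two_cocycle :
    MvPowerSeries.subst ![MvPowerSeries.subst ![(MvPowerSeries.X 0 : MvPowerSeries (Fin 3) A), MvPowerSeries.X 1] V.formalGroupLaw,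
          MvPowerSeries.X 2] V.formalQuasiPeriodCocycle +
        MvPowerSeries.subst ![(MvPowerSeries.X 0 : MvPowerSeries (Fin 3) A), MvPowerSeries.X 1] V.formalQuasiPeriodCocycle =
      MvPowerSeries.subst ![(MvPowerSeries.X 0 : MvPowerSeries (Fin 3) A),
          MvPowerSeries.subst ![(MvPowerSeries.X 1 : MvPowerSeries (Fin 3) A), MvPowerSeries.X 2] V.formalGroupLaw]
          V.formalQuasiPeriodCocycle +
        MvPowerSeries.subst ![(MvPowerSeries.X 1 : MvPowerSeries (Fin 3) A), MvPowerSeries.X 2] V.formalQuasiPeriodCocycle := by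
  rw [V.subst_pair_formalQuasiPeriodCocycle (V.constantCoeff_subst_X_pair_formalGroupLaw 0 1) (MvPowerSeries.constantCoeff_X 2),
    V.subst_pair_formalQuasiPeriodCocycle (MvPowerSeries.constantCoeff_X 0) (MvPowerSeries.constantCoeff_X 1),
    V.subst_pair_formalQuasiPeriodCocycle (MvPowerSeries.constantCoeff_X 0) (V.constantCoeff_subst_X_pair_formalGroupLaw 1 2),
    V.subst_pair_formalQuasiPeriodCocycle (MvPowerSeries.constantCoeff_X 1) (MvPowerSeries.constantCoeff_X 2),
    V.formalGroupLaw_assoc']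
  ring

end RatAlgebra

end WeierstrassCurve

namespace Literature.NumberTheory.PAdicHodge

open Literature.NumberTheory.GaloisRepresentations
open Literature.NumberTheory.GaloisRepresentations.IsNonarchimedeanLocalField
open Literature.NumberTheory.GaloisRepresentations.LubinTate

namespace AinfTop

variable {F : Type} [Field F] [ValuativeRel F] [TopologicalSpace F] [IsNonarchimedeanLocalField F] [CharZero F]
  {p : ℕ} [Fact p.Prime] [Fact (¬ IsUnit (p : integerC F))]
  [IsAdicComplete (Ideal.span {(p : integerC F)}) (integerC F)]
  {hθ : Function.Surjective (fontaineTheta (integerC F) p)}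
  (W : WeierstrassCurve ℤ)

/-! ## §2 The 2-cocycle identity for the integral cocycle `cocycleInt W ∈ ℤ⟦u, v⟧` -/

omit [CharZero F] [Fact p.Prime] [Fact (¬ IsUnit (p : integerC F))]
  [IsAdicComplete (Ideal.span {(p : integerC F)}) (integerC F)] in
/-- Base change of `C` along a pair: `(C(g, h)) ⊗ ℚ = C₀(g ⊗ ℚ, h ⊗ ℚ)`. [cite: Katz1981CrystallineDieudonne, §5.1] -/
theorem map_subst_pair_cocycleInt {σ : Type*} {g h : MvPowerSeries σ ℤ} (hg : MvPowerSeries.constantCoeff g = 0)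
    (hh : MvPowerSeries.constantCoeff h = 0) :
    MvPowerSeries.map (Int.castRingHom ℚ) (MvPowerSeries.subst ![g, h] (cocycleInt W)) =
      MvPowerSeries.subst ![MvPowerSeries.map (Int.castRingHom ℚ) g, MvPowerSeries.map (Int.castRingHom ℚ) h]
        (W.map (Int.castRingHom ℚ)).formalQuasiPeriodCocycle := by
  rw [MvPowerSeries.map_subst (WeierstrassCurve.hasSubst_pair hg hh), map_cocycleInt]
  congr 1
  funext k
  fin_cases k <;> rfl

omit [CharZero F] [Fact p.Prime] [Fact (¬ IsUnit (p : integerC F))]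
  [IsAdicComplete (Ideal.span {(p : integerC F)}) (integerC F)] in
/-- **The integral addition cocycle is a 2-cocycle**: `C(F(u,v), w) + C(u, v) = C(u, F(v,w)) + C(v, w)` in `ℤ⟦u, v, w⟧`
(from §1 by injectivity of `ℤ⟦u,v,w⟧ → ℚ⟦u,v,w⟧`). [cite: Katz1981CrystallineDieudonne, §5.1] -/
theorem cocycleInt_two_cocycle :
    MvPowerSeries.subst ![MvPowerSeries.subst ![(MvPowerSeries.X 0 : MvPowerSeries (Fin 3) ℤ), MvPowerSeries.X 1] W.formalGroupLaw,
          MvPowerSeries.X 2] (cocycleInt W) +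
        MvPowerSeries.subst ![(MvPowerSeries.X 0 : MvPowerSeries (Fin 3) ℤ), MvPowerSeries.X 1] (cocycleInt W) =
      MvPowerSeries.subst ![(MvPowerSeries.X 0 : MvPowerSeries (Fin 3) ℤ),
          MvPowerSeries.subst ![(MvPowerSeries.X 1 : MvPowerSeries (Fin 3) ℤ), MvPowerSeries.X 2] W.formalGroupLaw]
          (cocycleInt W) +
        MvPowerSeries.subst ![(MvPowerSeries.X 1 : MvPowerSeries (Fin 3) ℤ), MvPowerSeries.X 2] (cocycleInt W) := by
  apply WeierstrassCurve.mvPowerSeries_map_injective (φ := Int.castRingHom ℚ) Int.cast_injective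
  rw [map_add, map_add,
    map_subst_pair_cocycleInt W (W.constantCoeff_subst_X_pair_formalGroupLaw 0 1) (MvPowerSeries.constantCoeff_X 2),
    map_subst_pair_cocycleInt W (MvPowerSeries.constantCoeff_X 0) (MvPowerSeries.constantCoeff_X 1),
    map_subst_pair_cocycleInt W (MvPowerSeries.constantCoeff_X 0) (W.constantCoeff_subst_X_pair_formalGroupLaw 1 2),
    map_subst_pair_cocycleInt W (MvPowerSeries.constantCoeff_X 1) (MvPowerSeries.constantCoeff_X 2),
    W.map_subst_pair_formalGroupLaw _ (MvPowerSeries.constantCoeff_X 0) (MvPowerSeries.constantCoeff_X 1),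
    W.map_subst_pair_formalGroupLaw _ (MvPowerSeries.constantCoeff_X 1) (MvPowerSeries.constantCoeff_X 2),
    MvPowerSeries.map_X, MvPowerSeries.map_X, MvPowerSeries.map_X]
  exact (W.map (Int.castRingHom ℚ)).formalQuasiPeriodCocycle_two_cocycle

/-! ## §3 The 2-cocycle identity at points of `𝔫 ⊂ 𝔸_inf(F)`, and `Γ_F`-equivariance of `C(a, b)` -/

/-- `F(zᵢ, zⱼ)` read in three variables has no constant term (over `ℤ`). [cite: SilvermanAEC2009, IV.2.3] -/
private theorem cc_pairX (i j : Fin 3) :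
    MvPowerSeries.constantCoeff (MvPowerSeries.subst ![(MvPowerSeries.X i : MvPowerSeries (Fin 3) ℤ), MvPowerSeries.X j]
      W.formalGroupLaw) = 0 :=
  W.constantCoeff_subst_X_pair_formalGroupLaw i j

/-- Evaluating `F(zᵢ, zⱼ)` at `(a₀, a₁, a₂)` gives `aᵢ ⊕_W aⱼ`. [cite: CasselsFrohlichANT1967, Ch. VI §3.2] -/
theorem evalPt_subst_X_pair_formalGroupLaw (i j : Fin 3) (x : Fin 3 → (nilTheta F p hθ).toIdeal) :
    evalPt (nilTheta F p hθ) (MvPowerSeries.subst ![(MvPowerSeries.X i : MvPowerSeries (Fin 3) ℤ), MvPowerSeries.X j]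
        W.formalGroupLaw) (W.constantCoeff_subst_X_pair_formalGroupLaw i j) x = addW W (x i) (x j) := by
  have ha : ∀ s : Fin 2, ((![(MvPowerSeries.X i : MvPowerSeries (Fin 3) ℤ), MvPowerSeries.X j]) s).constantCoeff = 0 :=
    fun s => by fin_cases s <;> exact MvPowerSeries.constantCoeff_X _
  rw [evalPt_subst (nilTheta F p hθ) ha W.formalGroupLaw W.constantCoeff_formalGroupLaw, addW]
  congr 1
  funext s
  fin_cases s
  · exact evalPt_X (nilTheta F p hθ) i x
  · exact evalPt_X (nilTheta F p hθ) j x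

/-- Evaluating `C(f, g)` at a point: `C(f,g)(x) = C(f(x), g(x))`. [cite: Katz1981CrystallineDieudonne, §5.1] -/
theorem evalPt_subst_pair_cocycleInt {f g : MvPowerSeries (Fin 3) ℤ} (hf : MvPowerSeries.constantCoeff f = 0)
    (hg : MvPowerSeries.constantCoeff g = 0) (x : Fin 3 → (nilTheta F p hθ).toIdeal)
    (h : MvPowerSeries.constantCoeff (MvPowerSeries.subst ![f, g] (cocycleInt W)) = 0) :
    (evalPt (nilTheta F p hθ) (MvPowerSeries.subst ![f, g] (cocycleInt W)) h x : AinfTop F p) =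
      cocycleAt W hθ (evalPt (nilTheta F p hθ) f hf x) (evalPt (nilTheta F p hθ) g hg x) := by
  have ha : ∀ s : Fin 2, ((![f, g]) s).constantCoeff = 0 := fun s => by fin_cases s; exacts [hf, hg]
  rw [evalPt_subst (nilTheta F p hθ) ha (cocycleInt W) (constantCoeff_cocycleInt W), cocycleAt]
  congr 2
  funext s
  fin_cases s <;> rfl

/-- **The 2-cocycle identity at points: `C(a ⊕_W b, c) + C(a, b) = C(a, b ⊕_W c) + C(b, c)` in `𝔸_inf(F)`** for
`a, b, c ∈ 𝔫`. [cite: Katz1981CrystallineDieudonne, §5.1] [cite: FontaineAsterisque223III, Exp. II §1.2] -/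
theorem cocycleAt_two_cocycle (a b c : (nilTheta F p hθ).toIdeal) :
    cocycleAt W hθ (addW W a b) c + cocycleAt W hθ a b = cocycleAt W hθ a (addW W b c) + cocycleAt W hθ b c := by
  set x : Fin 3 → (nilTheta F p hθ).toIdeal := ![a, b, c] with hx
  have hX : ∀ i : Fin 3, MvPowerSeries.constantCoeff (MvPowerSeries.X i : MvPowerSeries (Fin 3) ℤ) = 0 :=
    fun i => MvPowerSeries.constantCoeff_X i
  have hC := constantCoeff_cocycleInt W
  have h1 : MvPowerSeries.constantCoeff (MvPowerSeries.subst ![MvPowerSeries.subst ![(MvPowerSeries.X 0 : MvPowerSeries (Fin 3) ℤ),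
      MvPowerSeries.X 1] W.formalGroupLaw, MvPowerSeries.X 2] (cocycleInt W)) = 0 :=
    constantCoeff_subst_zero (fun s => by fin_cases s; exacts [cc_pairX W 0 1, hX 2]) hC
  have h2 : MvPowerSeries.constantCoeff (MvPowerSeries.subst ![(MvPowerSeries.X 0 : MvPowerSeries (Fin 3) ℤ),
      MvPowerSeries.X 1] (cocycleInt W)) = 0 :=
    constantCoeff_subst_zero (fun s => by fin_cases s; exacts [hX 0, hX 1]) hC
  have h3 : MvPowerSeries.constantCoeff (MvPowerSeries.subst ![(MvPowerSeries.X 0 : MvPowerSeries (Fin 3) ℤ),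
      MvPowerSeries.subst ![(MvPowerSeries.X 1 : MvPowerSeries (Fin 3) ℤ), MvPowerSeries.X 2] W.formalGroupLaw]
      (cocycleInt W)) = 0 :=
    constantCoeff_subst_zero (fun s => by fin_cases s; exacts [hX 0, cc_pairX W 1 2]) hC
  have h4 : MvPowerSeries.constantCoeff (MvPowerSeries.subst ![(MvPowerSeries.X 1 : MvPowerSeries (Fin 3) ℤ),
      MvPowerSeries.X 2] (cocycleInt W)) = 0 :=
    constantCoeff_subst_zero (fun s => by fin_cases s; exacts [hX 1, hX 2]) hC
  -- evaluate the formal identity at `x = (a, b, c)`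
  have e := congrArg (MvPowerSeries.aeval ((nilTheta F p hθ).hasEval x)) (cocycleInt_two_cocycle W)
  simp only [map_add] at e
  rw [← coe_evalPt (nilTheta F p hθ) _ h1, ← coe_evalPt (nilTheta F p hθ) _ h2, ← coe_evalPt (nilTheta F p hθ) _ h3,
    ← coe_evalPt (nilTheta F p hθ) _ h4,
    evalPt_subst_pair_cocycleInt W (cc_pairX W 0 1) (hX 2) x h1, evalPt_subst_pair_cocycleInt W (hX 0) (hX 1) x h2,
    evalPt_subst_pair_cocycleInt W (hX 0) (cc_pairX W 1 2) x h3, evalPt_subst_pair_cocycleInt W (hX 1) (hX 2) x h4,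
    evalPt_subst_X_pair_formalGroupLaw W 0 1 x, evalPt_subst_X_pair_formalGroupLaw W 1 2 x,
    evalPt_X, evalPt_X, evalPt_X] at e
  simpa [hx] using e

omit [CharZero F] [IsAdicComplete (Ideal.span {(p : integerC F)}) (integerC F)] in
/-- `σ` fixes `ℤ ⊂ 𝔸_inf`. [folklore] -/
private theorem gal_algebraMap_int'' (σ : absoluteGaloisGroup F) (a : ℤ) :
    gal F p σ (algebraMap ℤ (AinfTop F p) a) = algebraMap ℤ (AinfTop F p) a := by
  rw [algebraMap_int_eq, eq_intCast, map_intCast]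

/-- **`Γ_F`-equivariance of the evaluated cocycle: `σ C(a, b) = C(σa, σb)`** (integral coefficients).
[cite: FontaineAsterisque223III, Exp. II §1.2] -/
theorem gal_cocycleAt (σ : absoluteGaloisGroup F) (a b : (nilTheta F p hθ).toIdeal) :
    gal F p σ (cocycleAt W hθ a b) =
      cocycleAt W hθ ⟨gal F p σ a, gal_mem_nilTheta σ a.2⟩ ⟨gal F p σ b, gal_mem_nilTheta σ b.2⟩ := by
  rw [cocycleAt, cocycleAt]
  exact gal_evalPt σ (gal_algebraMap_int'' σ) _ (constantCoeff_cocycleInt W) ![a, b]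
    ![⟨gal F p σ a, gal_mem_nilTheta σ a.2⟩, ⟨gal F p σ b, gal_mem_nilTheta σ b.2⟩] fun i => by
      fin_cases i
      · rfl
      · rfl

end AinfTop

end Literature.NumberTheory.PAdicHodge

end
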